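import Mathlib
import HarnessLib

/-!
# Venture HSemireg — the `|S| = 3` dictionary for level-uniform margins: TRIANGLE LAW ⟺ avoiding 3-transversal count (W5)

Bookkeeping of the computation cell `pub-hsemireg`, group W5 (notes `widen/W5/N7-FEASIBILITY-w5n7.md` §3.1 (the class equations
`A_S = A_{|S|}`, ROUTE A: `A_3 = k³ − m(3k + s)`) and §3.6 (b) (TRIANGLE LAW `T_{ijl} = |μ_i|² + |μ_j|² + |μ_l|² + m s`, «exact, from the
`|S| = 3` equation»); custodian seat w5-n6-1 gen 13, 2026-08-25; PLAIN, Mathlib only). Companion one level down of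
`UniformMarginIndependentCount` (w5-n6-2 g19, key 484: the `|S| = 4` count), whose triangle-law HYPOTHESES are exactly the right side
of `triangleLaw_iff_indepThree` below.

SETTING. Three finite level types `A, B, C` with `t_A, t_B, t_C` levels, margin functions `μ_A, μ_B, μ_C` with `Σ μ_X = m`, and three
matrices `xAB, xAC, xBC` over a commutative ring whose line sums through a level equal that level's margin (LEVEL-UNIFORM margins; arbitrary
entries). `p_X = Σ_ξ μ_X(ξ)²`, `T = Σ xAB·xAC·xBC` (the triangle count for 0∕1 data), `I₃ = Σ (1 − xAB)(1 − xAC)(1 − xBC)` (the number of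
3-transversals carrying no torus, for 0∕1 data).

* `indepThree_margin` — inclusion–exclusion with the margins summed out: `I₃ = t_A t_B t_C − m (t_A + t_B + t_C) + (p_A + p_B + p_C) − T`.
* `triangleLaw_iff_indepThree` — hence the printed `|S| = 3` class equation `I₃ = t_A t_B t_C − m (t_A + t_B + t_C) − m s` holds
  IFF the TRIANGLE LAW `T = p_A + p_B + p_C + m s` holds (N7F §3.6 (b)); at `t_X = k` the left value is ROUTE A's `A_3 = k³ − m(3k + s)`.

HONEST FRAMING: finite sums and ring arithmetic; nothing here says that HC, HC_CM or HC_AV holds, and no door ∕ tier ∕ report sentence of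
the cell is a consequence of this file alone.
-/

namespace Summit.Ventures.HSemireg
namespace UniformMarginTriangleDictionary
open Finset

variable {R : Type*} [CommRing R]
variable {A B C : Type*} [Fintype A] [Fintype B] [Fintype C]

/-- **Inclusion–exclusion for three coordinates with level-uniform margins**:
`Σ (1 − xAB)(1 − xAC)(1 − xBC) = t_A t_B t_C − m (t_A + t_B + t_C) + (p_A + p_B + p_C) − T`. -/
theorem indepThree_margin (tA tB tC m : R) (μA : A → R) (μB : B → R) (μC : C → R)
    (xAB : A → B → R) (xAC : A → C → R) (xBC : B → C → R)
    (hA : (Fintype.card A : R) = tA) (hB : (Fintype.card B : R) = tB) (hC : (Fintype.card C : R) = tC)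
    (hmA : ∑ a, μA a = m) (hmB : ∑ b, μB b = m)
    (rAB : ∀ a, ∑ b, xAB a b = μA a) (cAB : ∀ b, ∑ a, xAB a b = μB b)
    (rAC : ∀ a, ∑ c, xAC a c = μA a) (cAC : ∀ c, ∑ a, xAC a c = μC c)
    (rBC : ∀ b, ∑ c, xBC b c = μB b) (cBC : ∀ c, ∑ b, xBC b c = μC c) :
    ∑ a, ∑ b, ∑ c, (1 - xAB a b) * (1 - xAC a c) * (1 - xBC b c)
      = tA * tB * tC - m * (tA + tB + tC)
        + ((∑ a, μA a * μA a) + (∑ b, μB b * μB b) + (∑ c, μC c * μC c))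
        - ∑ a, ∑ b, ∑ c, xAB a b * xAC a c * xBC b c := by
  -- the eight monomials
  have h1 : ∑ _a : A, ∑ _b : B, ∑ _c : C, (1 : R) = tA * tB * tC := by
    simp only [Finset.sum_const, Finset.card_univ, nsmul_eq_mul, mul_one]
    rw [hA, hB, hC]; ring
  have h2 : ∑ a, ∑ b, ∑ _c : C, xAB a b = tC * m := by
    simp only [Finset.sum_const, Finset.card_univ, nsmul_eq_mul]
    rw [hC]
    simp_rw [← Finset.mul_sum, rAB, hmA]
  have h3 : ∑ a, ∑ _b : B, ∑ c, xAC a c = tB * m := by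
    simp only [Finset.sum_const, Finset.card_univ, nsmul_eq_mul]
    rw [hB]
    simp_rw [rAC, ← Finset.mul_sum, hmA]
  have h4 : ∑ _a : A, ∑ b, ∑ c, xBC b c = tA * m := by
    simp only [Finset.sum_const, Finset.card_univ, nsmul_eq_mul]
    rw [hA]
    simp_rw [rBC, hmB]
  have h5 : ∑ a, ∑ b, ∑ c, xAB a b * xAC a c = ∑ a, μA a * μA a := by
    refine Finset.sum_congr rfl fun a _ => ?_
    have ea : μA a * μA a = (∑ b, xAB a b) * (∑ c, xAC a c) := by rw [rAB, rAC]
    rw [ea, Finset.sum_mul_sum]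
  have h6 : ∑ a, ∑ b, ∑ c, xAB a b * xBC b c = ∑ b, μB b * μB b := by
    rw [Finset.sum_comm]
    refine Finset.sum_congr rfl fun b _ => ?_
    have eb : μB b * μB b = (∑ a, xAB a b) * (∑ c, xBC b c) := by rw [cAB, rBC]
    rw [eb, Finset.sum_mul_sum]
  have h7 : ∑ a, ∑ b, ∑ c, xAC a c * xBC b c = ∑ c, μC c * μC c := by
    have e : ∀ a, ∑ b, ∑ c, xAC a c * xBC b c = ∑ c, ∑ b, xAC a c * xBC b c := fun a => Finset.sum_comm
    simp_rw [e]
    rw [Finset.sum_comm]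
    refine Finset.sum_congr rfl fun c _ => ?_
    have ec : μC c * μC c = (∑ a, xAC a c) * (∑ b, xBC b c) := by rw [cAC, cBC]
    rw [ec, Finset.sum_mul_sum]
  -- pointwise expansion, then split the sums
  have pt : ∀ a b c, (1 - xAB a b) * (1 - xAC a c) * (1 - xBC b c)
      = 1 - xAB a b - xAC a c - xBC b c + xAB a b * xAC a c + xAB a b * xBC b c + xAC a c * xBC b c
        - xAB a b * xAC a c * xBC b c := by intros; ring
  simp_rw [pt]
  simp only [Finset.sum_add_distrib, Finset.sum_sub_distrib]
  rw [h1, h2, h3, h4, h5, h6, h7]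
  ring

/-- **The `|S| = 3` dictionary.** Under the same hypotheses the printed class equation
`I₃ = t_A t_B t_C − m (t_A + t_B + t_C) − m s` (N7F §3.1, `A_S = A_3`) holds iff the TRIANGLE LAW `T = p_A + p_B + p_C + m s`
(N7F §3.6 (b)) holds. -/
theorem triangleLaw_iff_indepThree (tA tB tC m s : R) (μA : A → R) (μB : B → R) (μC : C → R)
    (xAB : A → B → R) (xAC : A → C → R) (xBC : B → C → R)
    (hA : (Fintype.card A : R) = tA) (hB : (Fintype.card B : R) = tB) (hC : (Fintype.card C : R) = tC)
    (hmA : ∑ a, μA a = m) (hmB : ∑ b, μB b = m)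
    (rAB : ∀ a, ∑ b, xAB a b = μA a) (cAB : ∀ b, ∑ a, xAB a b = μB b)
    (rAC : ∀ a, ∑ c, xAC a c = μA a) (cAC : ∀ c, ∑ a, xAC a c = μC c)
    (rBC : ∀ b, ∑ c, xBC b c = μB b) (cBC : ∀ c, ∑ b, xBC b c = μC c) :
    (∑ a, ∑ b, ∑ c, (1 - xAB a b) * (1 - xAC a c) * (1 - xBC b c)
        = tA * tB * tC - m * (tA + tB + tC) - m * s)
      ↔ (∑ a, ∑ b, ∑ c, xAB a b * xAC a c * xBC b c
          = (∑ a, μA a * μA a) + (∑ b, μB b * μB b) + (∑ c, μC c * μC c) + m * s) := by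
  rw [indepThree_margin tA tB tC m μA μB μC xAB xAC xBC hA hB hC hmA hmB rAB cAB rAC cAC rBC cBC]
  constructor
  · intro h; linear_combination -h
  · intro h; linear_combination -h

end UniformMarginTriangleDictionary
end Summit.Ventures.HSemireg
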